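import Literature.NumberTheory.EllipticCurves.SteinWuthrich2013.MultiplicativeLeadingTerm
import Literature.NumberTheory.EllipticCurves.TateCurve.Twist
import Literature.NumberTheory.EllipticCurves.CanonicalPAdicHeightAdmissibleProofs
import Literature.NumberTheory.EllipticCurves.CanonicalPAdicHeightThetaProofs
import Literature.NumberTheory.EllipticCurves.PAdicHeightsLInvariantHoldsProofs
import Literature.NumberTheory.EllipticCurves.PAdicHeightsProofs
import Literature.Barriers.BirchSwinnertonDyer.PAdicHeightNondegeneracyProofs
import Literature.Barriers.BirchSwinnertonDyer.WeightHeightMinusHalfCyclotomic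
import Summits.BirchSwinnertonDyer.Rank1Residual.Additive.PadicLogFormalGroup
import Summits.BirchSwinnertonDyer.Rank1Residual.X11b.ClassClosureTyped
import HarnessLib

/-!
# The PINNING DICHOTOMY at a split multiplicative prime: of the two Stein–Wuthrich §4.2 heights
# that `ClassClosure.RegulatorNonvanishingAt W p` conjoins, AT LEAST ONE is non-degenerate in rank one

Cell `bsd-stepL`, seat `bsd-stepL-mult-p4` g5 (D-0131 (3) MIDDLE TIER, lens «split-multiplicative
`r = 1` via the `𝓛`-invariant `p`-adic Gross–Zagier»), answering planner RULING 34 (C) conjunct 3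
(«any class-wide handle on Schneider@3 for multiplicative-at-3 curves») from inside the tree.

At a SPLIT multiplicative prime `p` the tree carries TWO pinnings of the cyclotomic `p`-adic height
(`Literature/…/SteinWuthrich2013/MultiplicativeLeadingTerm.lean`): formula (4.1)
`heightFourOne W p q` (the Mazur–Tate sigma height, `IsMultCanonical Dh q`) and the §4.2 modified
height `heightSplit W p Dq = heightFourOne − log_p(u(P))²/log_p(q_E)` (Schneider's norm-adapted height,
`IsSplitMultCanonical Dh Dq`), and `X11b.ClassClosure.RegulatorNonvanishingAt W p` asks Schneider's
non-degeneracy for BOTH. This file PROVES (theorems only; 0 def ∕ fact ∕ sorry):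

* `heightFourOne_sub_heightSplit` — on an affine point the two pinnings differ by
  `log_E(z(P))² ∕ (C² · log_p q_E)` (definitional);
* `uniformisationScaleSq_ne_zero` — `C² ≠ 0` for a genuine Tate parameter (`j ≠ 0, 1728` on both
  sides, from `‖j‖_p > 1`);
* `padicFormalLog_ne_zero_of_isAdmissible` — `log_E(z(P)) ≠ 0` for an ADMISSIBLE rational point
  (non-torsion, in `E₁(ℚ_p)`): the formal-group logarithm kills exactly the torsion
  (`Additive.LocalLog.padicLog_eq_zero_iff` + `padicLogPoint_nsmul`);
* `heightFourOne_sub_heightSplit_ne_zero` — hence the difference is NON-ZERO on every admissible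
  point (`𝓛_p ≠ 0`: tree theorem `LInvariant_ne_zero_holds`, Barré-Sirieix–Diaz–Gramain–Philibert);
* `pairing_self_ne_of_pinnings` — two data pinned by (4.1) resp. §4.2 at the same split prime
  DISAGREE on every admissible point; in particular they are not both zero there;
* **`schneiderConjecture_or_of_rank_one`** — in rank one, `SchneiderConjecture Dh₍₄.₁₎ ∨
  SchneiderConjecture Dh_split`: if both regulators vanished, both pairings would vanish identically
  (`PAdicHeightData.pairing_eq_zero_of_rank_one`), contradicting the previous item at an admissible
  multiple of a generator (`exists_admissible_nsmul_holds`);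
* **`regulatorNonvanishingAt_left_or_right_of_rank_one`** — the class-level reading: for EVERY
  `E/ℚ` (globally minimal `W`), every prime `p` of split multiplicative reduction and
  `rank E(ℚ) = 1`, ONE of the two conjuncts of `ClassClosure.RegulatorNonvanishingAt W p` holds
  (uniqueness of the Tate parameter, `TateParameterData.q_unique_holds`).

* §5 (two-variable reading, pure algebra in the vocabulary of the barrier file
  `WeightHeightMinusHalfCyclotomic`): for a height–weight pairing with Venerucci's functional equation
  and Thm. 4.2 (2)-type data (`⟨q,q⟩^cyc = λ`, `⟨q,x⟩~ = ℓ{s−1}`), the extended `2 × 2` regulator is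
  `(s−1)²(λ⟨x,x⟩^cyc − ℓ²)` on the CYCLOTOMIC line (`extendedDet_cyclotomicLine`; `= λ·⟨x,x⟩^Sch`),
  `¼λ⟨x,x⟩^cyc(k−2)²` on the WEIGHT line (`four_mul_extendedDet_weightLine`) — versus `¼ℓ²(k−2)²` on
  the central critical line (the barrier's own `HWFunctionalEquation.extendedDet_central`) — and `lineDichotomy`: with `ℓ ≠ 0` the
  cyclotomic and weight regulators are never both zero.

* §6 (append): the degenerate branch in CLOSED FORM — if the §4.2 (split) pinning vanishes at an
  admissible point then the (4.1) pinning equals `log_E(z P)²/(C²·log_p q_E)` there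
  (`pairing_fourOne_eq_of_split_eq_zero`; rank one: `sq_mul_pairing_fourOne_eq_of_not_schneider_split`),
  and the two-line glue `of_twoLines` (a goal implied by either Schneider statement holds in rank one).

READING (memo `HOME/mult-p4/EXZ-ROAD-MEMO-g5.md` §2). The exceptional-zero road's Schneider stub
(`Cruxes/EulerHalvesAtThree/Lines/exz.lean`, `stub_regulatorNonvanishingAtThreeSurj`) is consumed on
the cyclotomic line through the §4.2 (split) pinning ONLY; the (4.1) pinning is the regulator of the
WEIGHT line of the two-variable `p`-adic `L`-function (barrier file
`WeightHeightMinusHalfCyclotomic`: `⟨P,P⟩^wt = −½⟨P,P⟩^cyc`, `⟨P,P⟩^Sch = ⟨P,P⟩^cyc − log_A(P)²/log_p q`).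
So the dichotomy says: class-wide, at every split multiplicative `p` and every rank-one curve, the
cyclotomic line OR the weight line is regulator-exact — a structural input no single line has.
Nothing here is a theorem about `Ш` or BSD; T7 — closes nothing.
-/

set_option linter.dupNamespace false
set_option autoImplicit false

noncomputable section

open scoped Classical

namespace Summit.BirchSwinnertonDyer.BirchSwinnertonDyer.Theorems.ExceptionalZeroRoad.Dichotomy

open WeierstrassCurve Literature.NumberTheory.EllipticCurves
  Literature.NumberTheory.EllipticCurves.SteinWuthrich2013
  Summit.BirchSwinnertonDyer.Rank1Residual

variable {W : WeierstrassCurve ℚ} {p : ℕ} [Fact p.Prime]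

/-! ### §1 The two pinnings differ by `log_E(z(P))² ∕ (C² log_p q_E)` -/

/-- **The (4.1) height minus the §4.2 split height is `log_p(u(P))²/log_p(q_E)`**
`= log_E(z(P))²/(C²·log_p q_E)` on an affine point (definitional: `heightSplitCoord =
heightFourOneCoord − logUnitParamSq / log_p q`). [cite: SteinWuthrich2013, §4.2 (p. 16, display)] -/
theorem heightFourOne_sub_heightSplit [W.IsElliptic] (Dq : TateParameterData W p)
    {x y : ℚ} (h : W.toAffine.Nonsingular x y) :
    heightFourOne W p Dq.q (.some x y h) - heightSplit W p Dq (.some x y h) =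
      logUnitParamSq W p Dq.q x y / padicLog p Dq.q := by
  show heightFourOneCoord W p Dq.q x y - heightSplitCoord W p Dq.q x y = _
  rw [heightSplitCoord]
  ring

/-- `j ≠ 1728` forces `c₆ ≠ 0` (`j − 1728 = c₆²/Δ`; same three lines as the tree's
`WeierstrassCurve.c₆_ne_zero_of_j_ne` in `WeierstrassFieldOfModuliProofs`, restated privately to keep
the import light). [cite: SilvermanAEC2009, III.1 (c-relations)] -/
private theorem c₆_ne_zero_of_j_ne' {K : Type*} [Field K] (E : WeierstrassCurve K) [E.IsElliptic]
    (h1728 : E.j ≠ 1728) : E.c₆ ≠ 0 := by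
  intro h
  apply h1728
  have hrel := E.c_relation
  rw [h, zero_pow two_ne_zero, sub_zero] at hrel
  rw [j, ← hrel, ← E.coe_Δ', mul_left_comm, Units.inv_mul, mul_one]

/-- **`C² ≠ 0`** for the uniformisation scale of a genuine Tate parameter (`q ≠ 0`, `‖q‖ < 1`,
`j(q) = j(E)`) at a multiplicative prime: `‖j(E)‖_p > 1` forces `j ≠ 0, 1728` for `E ⊗ ℚ_p` and for
the Tate curve `E_q` (`j(E_q) = j(q) = j(E)`), hence `c₄, c₆ ≠ 0` on both sides.
[cite: SilvermanATAEC1994, Lemma V.5.1 and Thm. V.5.3] [cite: SteinWuthrich2013, §4.2 (p. 15)] -/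
theorem uniformisationScaleSq_ne_zero [W.IsElliptic] (hmult : W.HasMultiplicativeReductionAtPrime p)
    {q : ℚ_[p]} (hq0 : q ≠ 0) (hq1 : ‖q‖ < 1) (hqj : tateJ q = (W.j : ℚ_[p])) :
    uniformisationScaleSq W p q ≠ 0 := by
  have hj : 1 < ‖(W.j : ℚ_[p])‖ := one_lt_norm_j_of_hasMultiplicativeReductionAtPrime hmult
  haveI := TateCurve.tateCurve_isElliptic hq0 hq1
  have hjq : (tateCurve q).j = (W.j : ℚ_[p]) := by rw [TateCurve.tateCurve_j hq1, hqj]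
  have hjW : (W.baseChange ℚ_[p]).j = (W.j : ℚ_[p]) :=
    (W.map_j (algebraMap ℚ ℚ_[p])).trans (eq_ratCast _ _)
  obtain ⟨h0q, h1728q⟩ :=
    TateCurve.j_ne_zero_and_ne_1728_of_one_lt_norm (E := tateCurve q) (by rwa [hjq])
  obtain ⟨h0W, h1728W⟩ :=
    TateCurve.j_ne_zero_and_ne_1728_of_one_lt_norm (E := W.baseChange ℚ_[p]) (by rwa [hjW])
  have hc4q : (tateCurve q).c₄ ≠ 0 := fun e ↦ h0q ((tateCurve q).j_eq_zero e)
  have hc6q : (tateCurve q).c₆ ≠ 0 := c₆_ne_zero_of_j_ne' _ h1728q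
  have hc4W : (W.baseChange ℚ_[p]).c₄ ≠ 0 := fun e ↦ h0W ((W.baseChange ℚ_[p]).j_eq_zero e)
  have hc6W : (W.baseChange ℚ_[p]).c₆ ≠ 0 := c₆_ne_zero_of_j_ne' _ h1728W
  unfold uniformisationScaleSq
  exact div_ne_zero (mul_ne_zero hc6q hc4W) (mul_ne_zero hc4q hc6W)

/-- **`log_E(z(P)) ≠ 0` for an admissible rational point** `P = (x, y)` (non-torsion, `‖x‖_p > 1`
i.e. `P ∈ E₁(ℚ_p)`): the `ℤ_p`-linear logarithm `log_ω` of `E(ℚ_p)` kills exactly the torsion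
(`Additive.LocalLog.padicLog_eq_zero_iff`), equals `log_W(z(N·P))/N = log_W(z(P))` on `E₁(ℚ_p)`
(`padicLog_eq_padicLogPoint_nsmul_div`, `padicLogPoint_nsmul`), and `E(ℚ) → E(ℚ_p)` is injective.
[cite: SilvermanAEC2009, IV.6.4 and VII.6.3] -/
theorem padicFormalLog_ne_zero_of_isAdmissible [W.IsElliptic] [W.IsGloballyMinimal]
    {x y : ℚ} {h : W.toAffine.Nonsingular x y} (hP : W.IsAdmissible p (.some x y h)) :
    (W.baseChange ℚ_[p]).padicFormalLog (-(x : ℚ_[p]) / y) ≠ 0 := by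
  set X : WeierstrassCurve ℚ_[p] := W.baseChange ℚ_[p] with hX
  set Pp : X.toAffine.Point := W.toPadicPoint p (.some x y h) with hPp
  have hPp' : Pp = .some (x : ℚ_[p]) (y : ℚ_[p]) (nonsingular_ratCast h) := toPadicPoint_some h
  have hker : X.IsInReductionKernel Pp := by
    rw [hPp']; exact hP.2.1
  have hntor : ¬ IsOfFinAddOrder Pp := by
    intro htor
    refine hP.1 ?_
    exact ((WeierstrassCurve.Affine.Point.map_injective
      (W' := W.toAffine) (f := Algebra.ofId ℚ ℚ_[p])).isOfFinAddOrder_iff).mp htor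
  have hlog : Additive.LocalLog.padicLog X Pp ≠ 0 :=
    fun e ↦ hntor ((Additive.LocalLog.padicLog_eq_zero_iff X Pp).mp e)
  rw [Additive.LocalLog.padicLog_eq_padicLogPoint_nsmul_div,
    Additive.LocalLog.padicLogPoint_nsmul X hker] at hlog
  have hpt : X.padicLogPoint Pp ≠ 0 := by
    intro e; apply hlog; rw [e, mul_zero, zero_div]
  rw [hPp'] at hpt
  exact hpt

/-- **`𝓛_p ≠ 0` gives `log_p q_E ≠ 0`** (`𝓛_p = log_p q_E / ord_p q_E`; tree theorem
`LInvariant_ne_zero_holds`, Barré-Sirieix–Diaz–Gramain–Philibert 1996).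
[cite: BarreSirieixDiazGramainPhilibert1996Manin, Thm. 1, Cor.] -/
theorem padicLog_q_ne_zero [W.IsElliptic] (Dq : TateParameterData W p) : padicLog p Dq.q ≠ 0 := by
  intro h0
  have hL : LInvariant Dq ≠ 0 := LInvariant_ne_zero_holds Dq
  apply hL
  rw [LInvariant, h0, zero_div]

/-- **The two pinnings differ by a NON-ZERO quantity on every admissible point** at a split
multiplicative prime: `h⁽⁴·¹⁾(P) − h^{split}(P) = log_E(z(P))²/(C²·log_p q_E) ≠ 0`.
[cite: SteinWuthrich2013, §4.2 (pp. 15–16)] [cite: BarreSirieixDiazGramainPhilibert1996Manin, Thm. 1, Cor.] -/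
theorem heightFourOne_sub_heightSplit_ne_zero [W.IsElliptic] [W.IsGloballyMinimal]
    (Dq : TateParameterData W p) {x y : ℚ} {h : W.toAffine.Nonsingular x y}
    (hP : W.IsAdmissible p (.some x y h)) :
    heightFourOne W p Dq.q (.some x y h) - heightSplit W p Dq (.some x y h) ≠ 0 := by
  rw [heightFourOne_sub_heightSplit Dq h]
  refine div_ne_zero ?_ (padicLog_q_ne_zero Dq)
  unfold logUnitParamSq
  exact div_ne_zero (pow_ne_zero 2 (padicFormalLog_ne_zero_of_isAdmissible hP))
    (uniformisationScaleSq_ne_zero Dq.split.hasMultiplicativeReductionAtPrime Dq.q_ne_zero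
      Dq.norm_q_lt_one Dq.tateJ_eq)

/-! ### §2 Datum level: two data pinned by (4.1) and by §4.2 disagree on admissible points -/

/-- **A (4.1)-pinned datum and a §4.2-pinned datum at the same split prime take DIFFERENT values
`⟨P,P⟩` on every admissible `P`.** [cite: SteinWuthrich2013, §4.2 (pp. 15–16)] -/
theorem pairing_self_ne_of_pinnings [W.IsElliptic] [W.IsGloballyMinimal] (Dq : TateParameterData W p)
    {Dh₁ Dh₂ : PAdicHeightData W p} (h₁ : IsMultCanonical Dh₁ Dq.q) (h₂ : IsSplitMultCanonical Dh₂ Dq)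
    {P : W.toAffine.Point} (hP : W.IsAdmissible p P) :
    Dh₁.pairing P P ≠ Dh₂.pairing P P := by
  rcases P with _ | ⟨x, y, h⟩
  · exact absurd hP.2 id
  · rw [h₁ _ hP, h₂ _ hP]
    exact sub_ne_zero.mp (heightFourOne_sub_heightSplit_ne_zero Dq hP)

/-- In particular **they are not both zero** on an admissible point. [cite: SteinWuthrich2013, §4.2] -/
theorem pairing_self_ne_zero_or [W.IsElliptic] [W.IsGloballyMinimal] (Dq : TateParameterData W p)
    {Dh₁ Dh₂ : PAdicHeightData W p} (h₁ : IsMultCanonical Dh₁ Dq.q) (h₂ : IsSplitMultCanonical Dh₂ Dq)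
    {P : W.toAffine.Point} (hP : W.IsAdmissible p P) :
    Dh₁.pairing P P ≠ 0 ∨ Dh₂.pairing P P ≠ 0 := by
  by_contra hcon
  obtain ⟨e₁, e₂⟩ := not_or.mp hcon
  exact pairing_self_ne_of_pinnings Dq h₁ h₂ hP ((not_not.mp e₁).trans (not_not.mp e₂).symm)

/-! ### §3 Rank one: the dichotomy of regulators -/

/-- **PINNING DICHOTOMY (rank one).** For `E/ℚ` (globally minimal `W`) of Mordell–Weil rank one and
`p` a prime of SPLIT multiplicative reduction (Tate datum `Dq`): if `Dh₁` is THE (4.1)-height and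
`Dh₂` THE §4.2 split height, then `Reg_p(E, Dh₁) ≠ 0 ∨ Reg_p(E, Dh₂) ≠ 0`. Proof: were both
regulators zero, both pairings would vanish identically on `E(ℚ)` (rank one:
`PAdicHeightData.not_schneiderConjecture_iff_of_rank_one`, `pairing_eq_zero_of_rank_one`), against
`pairing_self_ne_of_pinnings` at an admissible multiple of a point of infinite order
(`exists_admissible_nsmul_holds`). No hypothesis on `p` beyond split multiplicative reduction.
[cite: SteinWuthrich2013, §4.2 and Conj. 4.1] [cite: Schneider1982PadicHeightI, §1] -/
theorem schneiderConjecture_or_of_rank_one [W.IsElliptic] [W.IsGloballyMinimal]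
    (Dq : TateParameterData W p) {Dh₁ Dh₂ : PAdicHeightData W p}
    (h₁ : IsMultCanonical Dh₁ Dq.q) (h₂ : IsSplitMultCanonical Dh₂ Dq)
    (hr : W.mordellWeilRank = 1) :
    SchneiderConjecture Dh₁ ∨ SchneiderConjecture Dh₂ := by
  by_contra hcon
  obtain ⟨hc₁, hc₂⟩ := not_or.mp hcon
  obtain ⟨P₁, hP₁, h0₁⟩ :=
    (Dh₁.not_schneiderConjecture_iff_of_rank_one hr W.exists_isMordellWeilBasis_holds).mp hc₁
  obtain ⟨P₂, hP₂, h0₂⟩ :=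
    (Dh₂.not_schneiderConjecture_iff_of_rank_one hr W.exists_isMordellWeilBasis_holds).mp hc₂
  obtain ⟨m, -, hadm⟩ := exists_admissible_nsmul_holds W p P₁ hP₁
  have e₁ : Dh₁.pairing (m • P₁) (m • P₁) = 0 := Dh₁.pairing_eq_zero_of_rank_one hr hP₁ h0₁ _ _
  have e₂ : Dh₂.pairing (m • P₁) (m • P₁) = 0 := Dh₂.pairing_eq_zero_of_rank_one hr hP₂ h0₂ _ _
  rcases pairing_self_ne_zero_or Dq h₁ h₂ hadm with hne | hne
  · exact hne e₁
  · exact hne e₂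

/-! ### §4 Class level: one of the two conjuncts of `ClassClosure.RegulatorNonvanishingAt` holds -/

/-- **One of the two conjuncts of `X11b.ClassClosure.RegulatorNonvanishingAt W p` holds in rank one
at a split multiplicative prime.** For every `E/ℚ` (globally minimal `W`), every prime `p` of split
multiplicative reduction and `rank E(ℚ) = 1`: EITHER Schneider's non-degeneracy holds for every
(4.1)-pinned datum (the non-split-shaped conjunct, read at the Tate parameter of `E/ℚ_p`), OR it
holds for every §4.2-pinned datum (the split conjunct). The two universal statements reduce to the
rank-one dichotomy because the Tate parameter is unique (`eq_of_tateJ_eq`, ATAEC Lemma V.5.1). At a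
prime that is NOT split multiplicative there is no `TateParameterData`, so the right disjunct is
vacuous and the statement has content exactly on the split locus. Class-wide; no certificate;
nothing about `Ш`.
[cite: SteinWuthrich2013, §4.2 and Conj. 4.1] [cite: Schneider1982PadicHeightI, §1] -/
theorem regulatorNonvanishingAt_left_or_right_of_rank_one [W.IsElliptic] [W.IsGloballyMinimal]
    (hr : W.mordellWeilRank = 1) :
    (∀ (q : ℚ_[p]) (Dh : PAdicHeightData W p), q ≠ 0 → ‖q‖ < 1 → tateJ q = (W.j : ℚ_[p]) →
        IsMultCanonical Dh q → SchneiderConjecture Dh) ∨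
      (∀ (Dq : TateParameterData W p) (Dh : PAdicHeightData W p),
        IsSplitMultCanonical Dh Dq → SchneiderConjecture Dh) := by
  by_contra hcon
  obtain ⟨hl, hr'⟩ := not_or.mp hcon
  simp only [not_forall, exists_prop] at hl hr'
  obtain ⟨q, Dh₁, hq0, hq1, hqj, h₁, hS₁⟩ := hl
  obtain ⟨Dq, Dh₂, h₂, hS₂⟩ := hr'
  have hq : q = Dq.q :=
    eq_of_tateJ_eq hq0 hq1 Dq.q_ne_zero Dq.norm_q_lt_one (hqj.trans Dq.tateJ_eq.symm)
  subst hq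
  rcases schneiderConjecture_or_of_rank_one Dq h₁ h₂ hr with hS | hS
  · exact hS₁ hS
  · exact hS₂ hS

/-- The same with the conclusion spelled through `ClassClosure.RegulatorNonvanishingAt`'s two
conjuncts as stand-alone `Prop`s: `RegulatorNonvanishingAt W p` is `left ∧ right`; in rank one at a
split prime `left ∨ right` is a THEOREM, so the conjunction follows from the two cross-implications
`left → right`, `right → left` (this is how a road that can consume EITHER pinning discharges the
stub `stub_regulatorNonvanishingAtThreeSurj` of `Lines/exz.lean` on the split locus).
[cite: SteinWuthrich2013, §4.2 and Conj. 4.1] -/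
theorem regulatorNonvanishingAt_of_both_of_rank_one [W.IsElliptic] [W.IsGloballyMinimal]
    (hr : W.mordellWeilRank = 1)
    (hleft : (∀ (Dq : TateParameterData W p) (Dh : PAdicHeightData W p),
        IsSplitMultCanonical Dh Dq → SchneiderConjecture Dh) →
      ∀ (q : ℚ_[p]) (Dh : PAdicHeightData W p), q ≠ 0 → ‖q‖ < 1 → tateJ q = (W.j : ℚ_[p]) →
        IsMultCanonical Dh q → SchneiderConjecture Dh)
    (hright : (∀ (q : ℚ_[p]) (Dh : PAdicHeightData W p), q ≠ 0 → ‖q‖ < 1 →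
        tateJ q = (W.j : ℚ_[p]) → IsMultCanonical Dh q → SchneiderConjecture Dh) →
      ∀ (Dq : TateParameterData W p) (Dh : PAdicHeightData W p),
        IsSplitMultCanonical Dh Dq → SchneiderConjecture Dh) :
    X11b.ClassClosure.RegulatorNonvanishingAt W p := by
  rcases regulatorNonvanishingAt_left_or_right_of_rank_one (p := p) hr with h | h
  · exact ⟨h, hright h⟩
  · exact ⟨hleft h, h⟩


/-! ### §5 Two-variable reading (barrier `WeightHeightMinusHalfCyclotomic`'s vocabulary): the
(4.1)-pinning is the WEIGHT-line regulator, the §4.2-pinning the CYCLOTOMIC-line regulator -/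

section TwoVariableReading

open Literature.Barriers.BirchSwinnertonDyer

variable {M R : Type*} [AddCommGroup M] [CommRing R] {hc hw : M →+ M →+ R}

/-- **Extended determinant on the CYCLOTOMIC line `k = 2`.** For a height–weight pairing with
Venerucci's functional equation, the Tate-period class `q` with `⟨q,q⟩^cyc = λ` (`= log_p q_A`) and a
class `x` with `⟨q,x⟩~(k,s) = ℓ·(s − 1)` (`ℓ = log_A(res_p x)`; Thm. 4.2 (2)):
`(⟨q,q⟩~⟨x,x⟩~ − ⟨q,x⟩~⟨x,q⟩~)(2,s) = (s − 1)² · (λ·⟨x,x⟩^cyc − ℓ²)` — the cyclotomic-line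
regulator of the extended group is `λ·⟨x,x⟩^cyc − ℓ² = λ·(⟨x,x⟩^cyc − ℓ²/λ) = log_p(q_A)·⟨x,x⟩^Sch`
(Schneider's norm-adapted height, Venerucci Thm. D). [cite: Venerucci2015, §4.3.3 Thm. 4.2 (2), (3)]
[cite: Venerucci2015, §1.2 Thm. D] -/
theorem extendedDet_cyclotomicLine (h : HWFunctionalEquation hc hw) (q x : M) (lam ℓ : R)
    (hcq : hc q q = lam) (hqx : ∀ k s, hwPairing hc hw q x k s = ℓ * (s - 1)) (s : R) :
    hwPairing hc hw q q 2 s * hwPairing hc hw x x 2 s -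
        hwPairing hc hw q x 2 s * hwPairing hc hw x q 2 s =
      (s - 1) ^ 2 * (lam * hc x x - ℓ ^ 2) := by
  have exq : hwPairing hc hw x q 2 s = -(ℓ * (2 - s - 1)) := by rw [h q x 2 s, hqx]
  rw [hwPairing_two_left, hwPairing_two_left, hqx, exq, hcq]
  ring

/-- **Extended determinant on the WEIGHT line `s = 1`.** Same data:
`4·(⟨q,q⟩~⟨x,x⟩~ − ⟨q,x⟩~⟨x,q⟩~)(k,1) = λ · ⟨x,x⟩^cyc · (k − 2)²` — the weight-line regulator of the
extended group is `¼ log_p(q_A)·⟨x,x⟩^cyc`, the CANONICAL cyclotomic height itself (`2⟨y,y⟩^wt =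
−⟨y,y⟩^cyc`, `WeightHeightMinusHalfCyclotomic`). [cite: Venerucci2015, §4.3.3 Thm. 4.2 (2), (3)]
[cite: Venerucci2015, §1.2 Thm. E] -/
theorem four_mul_extendedDet_weightLine (h : HWFunctionalEquation hc hw) (q x : M) (lam ℓ : R)
    (hcq : hc q q = lam) (hqx : ∀ k s, hwPairing hc hw q x k s = ℓ * (s - 1)) (k : R) :
    4 * (hwPairing hc hw q q k 1 * hwPairing hc hw x x k 1 -
        hwPairing hc hw q x k 1 * hwPairing hc hw x q k 1) =
      lam * hc x x * (k - 2) ^ 2 := by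
  have eq2 := h.two_mul_wt_self q
  have ex2 := h.two_mul_wt_self x
  rw [hwPairing_one_right, hwPairing_one_right, hqx, hcq] at *
  linear_combination (2 * hw x x * (k - 2) ^ 2) * eq2 - (lam * (k - 2) ^ 2) * ex2

/-- **LINE DICHOTOMY (abstract).** With `λ ≠ 0` (`𝓛_p ≠ 0`) and `ℓ ≠ 0` (`x` not locally torsion)
in a domain: the cyclotomic-line regulator `λ⟨x,x⟩^cyc − ℓ²` and the weight-line regulator
`λ⟨x,x⟩^cyc` are NOT BOTH zero — their difference is `ℓ² ≠ 0`. This is the two-variable shadow of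
`pairing_self_ne_zero_or` / `schneiderConjecture_or_of_rank_one` (dictionary: `⟨x,x⟩^cyc ↔` the
(4.1) pinning, `⟨x,x⟩^cyc − ℓ²/λ ↔` the §4.2 split pinning, `ℓ²/λ ↔ log_E(z P)²/(C² log_p q_E)`).
[cite: Venerucci2015, §1.2 Thms. D, E] [cite: SteinWuthrich2013, §4.2] -/
theorem lineDichotomy [IsDomain R] {lam ℓ : R} (hℓ : ℓ ≠ 0) (c : R) :
    lam * c - ℓ ^ 2 ≠ 0 ∨ lam * c ≠ 0 := by
  by_cases h0 : lam * c = 0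
  · left
    rw [h0, zero_sub, neg_ne_zero]
    exact pow_ne_zero 2 hℓ
  · exact Or.inr h0

end TwoVariableReading

/-! ### §6 (append, g5) The degenerate branch in closed form, and the two-line glue
If the split pinning IS degenerate in rank one, the (4.1) pinning is KNOWN in closed form on admissible
points (what a weight-line display would have to match on such a pair; memo `EXZ-ROAD-MEMO-g5.md` §3);
and a goal that follows from either Schneider statement separately holds outright in rank one. -/

/-- **Degenerate split pinning ⇒ the (4.1) height is explicit**: if a §4.2-pinned datum vanishes at an
admissible `P = (x, y)`, then every (4.1)-pinned datum takes the value `log_E(z P)²/(C²·log_p q_E)`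
there. [cite: SteinWuthrich2013, §4.2 (pp. 15–16)] -/
theorem pairing_fourOne_eq_of_split_eq_zero [W.IsElliptic] [W.IsGloballyMinimal]
    (Dq : TateParameterData W p) {Dh₁ Dh₂ : PAdicHeightData W p}
    (h₁ : IsMultCanonical Dh₁ Dq.q) (h₂ : IsSplitMultCanonical Dh₂ Dq)
    {x y : ℚ} {h : W.toAffine.Nonsingular x y} (hP : W.IsAdmissible p (.some x y h))
    (h0 : Dh₂.pairing (.some x y h) (.some x y h) = 0) :
    Dh₁.pairing (.some x y h) (.some x y h) = logUnitParamSq W p Dq.q x y / padicLog p Dq.q := by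
  have e := heightFourOne_sub_heightSplit Dq h
  rw [← h₁ _ hP, ← h₂ _ hP, h0, sub_zero] at e
  exact e

/-- **Rank one, degenerate split regulator ⇒ the (4.1) pairing of every point is pinned**: if
`Reg_p(E, Dh_split) = 0` then `m²·⟨P,P⟩₍₄.₁₎ = log_E(z(mP))²/(C²·log_p q_E)` whenever `m • P = (x,y)` is
admissible. [cite: SteinWuthrich2013, §4.2 and Conj. 4.1] -/
theorem sq_mul_pairing_fourOne_eq_of_not_schneider_split [W.IsElliptic] [W.IsGloballyMinimal]
    (Dq : TateParameterData W p) {Dh₁ Dh₂ : PAdicHeightData W p}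
    (h₁ : IsMultCanonical Dh₁ Dq.q) (h₂ : IsSplitMultCanonical Dh₂ Dq)
    (hr : W.mordellWeilRank = 1) (hS : ¬ SchneiderConjecture Dh₂)
    {P : W.toAffine.Point} {m : ℕ} {x y : ℚ} {h : W.toAffine.Nonsingular x y}
    (hm : m • P = .some x y h) (hadm : W.IsAdmissible p (.some x y h)) :
    ((m : ℚ_[p]) ^ 2) * Dh₁.pairing P P = logUnitParamSq W p Dq.q x y / padicLog p Dq.q := by
  obtain ⟨P₂, hP₂, h0₂⟩ :=
    (Dh₂.not_schneiderConjecture_iff_of_rank_one hr W.exists_isMordellWeilBasis_holds).mp hS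
  have hzero : Dh₂.pairing (.some x y h) (.some x y h) = 0 :=
    Dh₂.pairing_eq_zero_of_rank_one hr hP₂ h0₂ _ _
  have e := pairing_fourOne_eq_of_split_eq_zero Dq h₁ h₂ hadm hzero
  rw [← hm] at e
  simp only [map_nsmul, AddMonoidHom.nsmul_apply, nsmul_eq_mul] at e
  rw [← e]
  ring

/-- **Two-line glue.** In rank one, a statement `U` that follows from Schneider's non-degeneracy of
the split pinning AND, separately, from that of the (4.1) pinning holds outright — e.g.
`U = Typed.MissingUpperBoundAt W p` fed by the cyclotomic-line consumer and by a weight-line consumer.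
[cite: SteinWuthrich2013, §4.2 and Conj. 4.1] [cite: Venerucci2015, §1.2 Thms. D, E] -/
theorem of_twoLines [W.IsElliptic] [W.IsGloballyMinimal] (hr : W.mordellWeilRank = 1) {U : Prop}
    (hcyc : (∀ (Dq : TateParameterData W p) (Dh : PAdicHeightData W p),
        IsSplitMultCanonical Dh Dq → SchneiderConjecture Dh) → U)
    (hwt : (∀ (q : ℚ_[p]) (Dh : PAdicHeightData W p), q ≠ 0 → ‖q‖ < 1 → tateJ q = (W.j : ℚ_[p]) →
        IsMultCanonical Dh q → SchneiderConjecture Dh) → U) : U := by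
  rcases regulatorNonvanishingAt_left_or_right_of_rank_one (p := p) hr with h | h
  · exact hwt h
  · exact hcyc h

end Summit.BirchSwinnertonDyer.BirchSwinnertonDyer.Theorems.ExceptionalZeroRoad.Dichotomy

end
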